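import Summits.ResolutionOfSingularities.ResolutionOfSingularities.Theorems.SplitTowerEta
import Literature.RingTheory.Koszul.MinimalGeneratorsInvariance

/-!
# SplitTower (T6/·) — THE CHART LAWS I: the dictionary of a chart point, the `NotPow` charts, the core charts

Node «SplitTower» of `decomp-res-lens-2` (g34), see `Theorems/MaxContactCutSplitTower.lean`.

The setting of every law: `A` local (a stalk of the ambient threefold), `c = (c₀, c₁, c₂)` quasi-regular in `𝔪_A`,
`f = splitCone c₀ c₁ G n + ε c₂ᵏ + h ∈ J` a split cone, a chart index `j`, a prime `𝔴` of the Rees chart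
`B_j = A[c/c_j]` over `𝔪_A`, `S = (B_j)_𝔴` (a stalk of the blow-up along `V(c)`), `χ : B_j → S`, `σ : A → S` the
structure maps, `t = σ c_j` and `J' = (J S : tⁿ)` the controlled transform.

* §D `chart_dict` — `σ c_l = t·χ e_l`, `σ⁻¹ 𝔪_S = 𝔪_A`, `χ⁻¹ 𝔪_S = 𝔴`, `χ e_j = 1`.
* §R `SplitShape.finrank_eq` (`edim A = 4`); `isRsopPart_fibre_chart` — at a prime `𝔴 ∋ e_l` the triple
  `(t, σ ϖ, χ e_l)` is part of a regular system of parameters of `S` (`(c, ϖ)` one of `A`); `isRsopPart_origin_chart`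
  — at the origin of the `W`-chart `(χ e₀, χ e₁, t, σ w)` is one.
* §N `notPow_chart` — THE UNIT / GENERIC TYPE: if the vertex coefficients are `NotPow` over `κ(A)` and `J' ⊆ 𝔪_Sⁿ`
  then `j = 2` and `e₀, e₁ ∈ 𝔴` (KERNELS W/U/Z of `SplitTowerPoly` through the fibre test of `SplitTowerQuot`).
* §C `core_chart_top` — THE CORE TYPE (`Gᵢ ∈ 𝔪_A`, `1 ≤ i ≤ n`): off `{e₀ ∈ 𝔴}` (and in the whole `z`-chart) the
  controlled transform is a unit: `J' = S`.

Sources: [Matsumura1987] Thms. 14.2, 16.2; [Hironaka1964] Ch. III §3; [CossartJannsenSaito2020] Ch. 2, Ch. 8.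
-/

open IsLocalRing
open Literature.AlgebraicGeometry.Resolution
open Summit.ResolutionOfSingularities.ResolutionOfSingularities.Theorems.SplitCut (splitCone MiddleCoeff VertexTame)
open Summit.ResolutionOfSingularities.ResolutionOfSingularities.Theorems.JetCut (WtIdeal)
open Summit.ResolutionOfSingularities.ResolutionOfSingularities.Theorems.PurityCut (BinomGuard)
open Summit.ResolutionOfSingularities.ResolutionOfSingularities.Theorems.TowerCut (mem_colon_of_map_eq
  isUnit_add_of_mem exists_append_of_isRsopPart)

namespace Summit.ResolutionOfSingularities.ResolutionOfSingularities.Theorems.SplitTower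

variable {A : Type} [CommRing A] [IsLocalRing A]

/-! ## §D  The dictionary of a chart point -/

section Dict

variable {m : ℕ} (c : Fin m → A) (j : Fin m) (𝔴 : PrimeSpectrum (chartRing c j)) {S : Type} [CommRing S]
  [IsLocalRing S] (χ : chartRing c j →+* S) (hlocχ : @IsLocalization.AtPrime _ _ S _ χ.toAlgebra 𝔴.asIdeal _)
  (h𝔴 : 𝔴.asIdeal.comap (chartBase c j) = maximalIdeal A) (σ : A →+* S) (hσ : ∀ x, χ (chartBase c j x) = σ x)

include hlocχ h𝔴 hσ in
/-- **The dictionary of a chart point**: `σ c_l = t · χ e_l`; `σ x ∈ 𝔪_S ↔ x ∈ 𝔪_A`; `χ b ∈ 𝔪_S ↔ b ∈ 𝔴`;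
`χ e_j = 1`. [cite: StacksProject, Tag 052P] -/
theorem chart_dict :
    (∀ l, σ (c l) = σ (c j) * χ (chartGen c j l)) ∧ (∀ x, σ x ∈ maximalIdeal S ↔ x ∈ maximalIdeal A) ∧
      (∀ b, χ b ∈ maximalIdeal S ↔ b ∈ 𝔴.asIdeal) ∧ χ (chartGen c j j) = 1 := by
  letI := χ.toAlgebra
  haveI : IsLocalization.AtPrime S 𝔴.asIdeal := hlocχ
  have halg : ∀ b, algebraMap (chartRing c j) S b = χ b := fun b =>
    RingHom.congr_fun (RingHom.algebraMap_toAlgebra χ) b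
  have hχ : ∀ b, χ b ∈ maximalIdeal S ↔ b ∈ 𝔴.asIdeal := fun b => by
    rw [← halg]; exact IsLocalization.AtPrime.to_map_mem_maximal_iff S 𝔴.asIdeal b
  refine ⟨fun l => ?_, fun x => ?_, hχ, ?_⟩
  · rw [← hσ, ← hσ, ← map_mul, ← reesChartBase_apply_eq_mul_chartGen c j l]
  · rw [← hσ, hχ, ← Ideal.mem_comap, h𝔴]
  · rw [show chartGen c j j = 1 from chartGen_self c j, map_one]

end Dict

/-! ## §R  Regular parameters at chart points -/

section Rsop

/-- `range (Fin.append c ![ϖ]) = range c ∪ {ϖ}`. [folklore] -/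
theorem range_append_one {α : Type} {m : ℕ} (c : Fin m → α) (ϖ : α) :
    Set.range (Fin.append c ![ϖ]) = Set.range c ∪ {ϖ} := by
  rw [range_fin_append, Matrix.range_cons, Matrix.range_empty, Set.union_empty]

variable {J P : Ideal A} {n k : ℕ}

/-- The embedding dimension of the ring of a split shape is `4`. [folklore] -/
theorem SplitShape.finrank_eq (D : SplitShape J P n k) : (maximalIdeal A).spanFinrank = 4 := by
  haveI := D.isRegularLocalRing
  refine le_antisymm ?_ ?_
  · exact Literature.RingTheory.Koszul.spanFinrank_le_of_span_eq (x := Fin.append D.c ![D.w])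
      (by rw [range_append_one]; exact D.span_cw)
  · obtain ⟨e, y, hd, -⟩ := exists_append_of_isRsopPart D.rsop_cw
    omega

/-- **Regular parameters on the fibre line**: `(c, ϖ)` a regular system of parameters of `A` (`edim A = 4`), `𝔴` a
prime of the chart `B_j` over `𝔪_A` with `e_l ∈ 𝔴` (`l ≠ j`), `S = (B_j)_𝔴`: `(t, σ ϖ, χ e_l)` is part of a regular
system of parameters of `S`. [cite: DeJong1996, 2.4] [cite: StacksProject, Tag 0BIQ] -/
theorem isRsopPart_fibre_chart {R : Type} [CommRing R] [IsRegularLocalRing R] (c : Fin 3 → R) (ϖ : R)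
    (hW : Ideal.span (Set.range c ∪ {ϖ}) = maximalIdeal R) (hd : (maximalIdeal R).spanFinrank = 4) (j : Fin 3)
    (𝔴 : PrimeSpectrum (chartRing c j)) (S : Type) [CommRing S] [IsLocalRing S] [Algebra (chartRing c j) S]
    [IsLocalization.AtPrime S 𝔴.asIdeal] (h𝔴 : 𝔴.asIdeal.comap (chartBase c j) = maximalIdeal R) {l : Fin 3}
    (hl : l ≠ j) (h0 : chartGen c j l ∈ 𝔴.asIdeal) :
    IsRsopPart ![(algebraMap (chartRing c j) S : chartRing c j →+* S) (chartBase c j (c j)),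
      (algebraMap (chartRing c j) S : chartRing c j →+* S) (chartBase c j ϖ),
      (algebraMap (chartRing c j) S : chartRing c j →+* S) (chartGen c j l)] := by
  have jJinj : Function.Injective (fun _ : Fin 1 => (⟨l, hl⟩ : {i : Fin 3 // i ≠ j})) :=
    fun a b _ => Subsingleton.elim a b
  have hfam := isRsopPart_chartFamily_reesChart (c := c) (i := j) ![ϖ] (by rw [range_append_one]; exact hW) hd
    𝔴.asIdeal h𝔴 S (fun _ : Fin 1 => ⟨l, hl⟩) jJinj (fun _ => h0)
  have hι : Function.Injective ![(0 : Fin (1 + 1 + 1)), Fin.succ (Fin.natAdd 1 (0 : Fin 1)),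
      Fin.succ (Fin.castAdd 1 (0 : Fin 1))] := by decide
  convert hfam.comp _ hι using 1
  funext i
  fin_cases i
  · simp [chartFamily]
  · simp [chartFamily]; rfl
  · simp [chartFamily]; rfl

/-- **Regular parameters at the origin of the `W`-chart**: `(c, W)` a regular system of parameters of `A`, `𝔴` a
prime of `B₂` over `𝔪_A` containing `e₀, e₁`, `S = (B₂)_𝔴`: `(χ e₀, χ e₁, t, σ W_i)` is part of a regular system
of parameters of `S`. [cite: DeJong1996, 2.4] [cite: StacksProject, Tag 0BIQ] -/
theorem isRsopPart_origin_chart {R : Type} [CommRing R] [IsRegularLocalRing R] (c : Fin 3 → R) {l : ℕ} (W : Fin l → R)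
    (hW : Ideal.span (Set.range (Fin.append c W)) = maximalIdeal R) (hd : (maximalIdeal R).spanFinrank = 3 + l)
    (𝔴 : PrimeSpectrum (chartRing c 2)) (S : Type) [CommRing S] [IsLocalRing S] [Algebra (chartRing c 2) S]
    [IsLocalization.AtPrime S 𝔴.asIdeal] (h𝔴 : 𝔴.asIdeal.comap (chartBase c 2) = maximalIdeal R)
    (h0 : chartGen c 2 0 ∈ 𝔴.asIdeal) (h1 : chartGen c 2 1 ∈ 𝔴.asIdeal) (i : Fin l) :
    IsRsopPart ![(algebraMap (chartRing c 2) S : chartRing c 2 →+* S) (chartGen c 2 0),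
      (algebraMap (chartRing c 2) S : chartRing c 2 →+* S) (chartGen c 2 1),
      (algebraMap (chartRing c 2) S : chartRing c 2 →+* S) (chartBase c 2 (c 2)),
      (algebraMap (chartRing c 2) S : chartRing c 2 →+* S) (chartBase c 2 (W i))] := by
  set jJ : Fin 2 → {i : Fin 3 // i ≠ 2} := ![⟨0, by decide⟩, ⟨1, by decide⟩] with hjJ
  have jJinj : Function.Injective jJ := by decide
  have hfam := isRsopPart_chartFamily_reesChart (c := c) (i := 2) W hW hd 𝔴.asIdeal h𝔴 S jJ jJinj
    (fun a => by fin_cases a; exacts [h0, h1])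
  have hι : Function.Injective ![Fin.succ (Fin.castAdd l (0 : Fin 2)), Fin.succ (Fin.castAdd l (1 : Fin 2)),
      (0 : Fin (2 + l + 1)), Fin.succ (Fin.natAdd 2 i)] := by
    intro a b h
    fin_cases a <;> fin_cases b <;>
      first
      | rfl
      | (exfalso; simp [Fin.ext_iff] at h; try omega)
  convert hfam.comp _ hι using 1
  funext a
  fin_cases a
  · simp [chartFamily, hjJ]
  · simp [chartFamily, hjJ]
  · simp [chartFamily]
  · simp [chartFamily]

end Rsop

/-! ## §N  The `NotPow` charts -/

section NotPowChart

open MvPolynomial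

omit [IsLocalRing A] in
/-- `splitCone 1 U g n = Σ gᵢ Uⁱ`. [folklore] -/
theorem splitCone_one_left (U : A) (g : ℕ → A) (n : ℕ) :
    splitCone 1 U g n = ∑ i ∈ Finset.range (n + 1), g i * U ^ i := by
  simp [splitCone]

omit [IsLocalRing A] in
/-- `splitCone z 1 g n = Σ gᵢ z^{n−i}`. [folklore] -/
theorem splitCone_one_right (z : A) (g : ℕ → A) (n : ℕ) :
    splitCone z 1 g n = ∑ i ∈ Finset.range (n + 1), g i * z ^ (n - i) := by
  simp [splitCone]

omit [IsLocalRing A] in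
set_option maxHeartbeats 400000 in -- WRITER NOTE (g16): pre-budgeted (elaboration exceeds 100k = half the tree default; ops-buildfix standing ask)
/-- **THE `NotPow` CHART LAW (abstract fibre)**: `Φ : B_j → K[X_l : l ≠ j]` a ring map to a polynomial ring over a
FIELD with `Φ e_l = X_l`, `Φ(φ a) = ψ a` (constants), `ψ c_j = 0`, and `𝔫 ⊆ K[X]` a prime with `Φ⁻¹ 𝔫 = 𝔴`; if the
coefficient string `ψ G` is `NotPow` over `K` and the controlled transform `J' = (J S : tⁿ)` lies in `𝔪_Sⁿ`, then the point
is the origin of the `W`-chart: `j = 2` and `e₀, e₁ ∈ 𝔴` (`z`-chart: KERNEL Z; `u`-chart: KERNEL U; `W`-chart: KERNEL W).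
[cite: Hironaka1964, Ch. III §3] [cite: CossartJannsenSaito2020, Ch. 8] -/
theorem notPow_chart_of_fibre (c : Fin 3 → A) {J : Ideal A} {G : ℕ → A} {ε h : A} {n k : ℕ}
    (hf : splitCone (c 0) (c 1) G n + ε * c 2 ^ k + h ∈ J) (hh : h ∈ WtIdeal c n k (n * k + 1)) (hn : 1 ≤ n)
    (hk : n + 1 ≤ k) (hG0 : G 0 = 1) (j : Fin 3) (𝔴 : PrimeSpectrum (chartRing c j)) {S : Type} [CommRing S]
    [IsLocalRing S] (χ : chartRing c j →+* S) (hlocχ : @IsLocalization.AtPrime _ _ S _ χ.toAlgebra 𝔴.asIdeal _)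
    (σ : A →+* S) (hσ : ∀ x, χ (chartBase c j x) = σ x) {K : Type} [Field K] (ψ : A →+* K)
    (hNP : NotPow K n (fun i => ψ (G i))) (Φ : chartRing c j →+* MvPolynomial {i : Fin 3 // i ≠ j} K)
    (hΦgen : ∀ l (hl : l ≠ j), Φ (chartGen c j l) = X ⟨l, hl⟩) (hΦbase : ∀ a, Φ (chartBase c j a) = C (ψ a))
    (hψj : ψ (c j) = 0) (𝔫 : Ideal (MvPolynomial {i : Fin 3 // i ≠ j} K)) (h𝔫 : 𝔫.IsPrime)
    (hΦ𝔴 : ∀ b, b ∈ 𝔴.asIdeal ↔ Φ b ∈ 𝔫)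
    (hle : Submodule.colon (J.map σ) ((Ideal.span {σ (c j)} ^ n : Ideal S) : Set S) ≤ maximalIdeal S ^ n) :
    j = 2 ∧ ∀ l, l ≠ j → chartGen c j l ∈ 𝔴.asIdeal := by
  classical
  letI := χ.toAlgebra
  haveI : IsLocalization.AtPrime S 𝔴.asIdeal := hlocχ
  have halg : ∀ b, algebraMap (chartRing c j) S b = χ b := fun b =>
    RingHom.congr_fun (RingHom.algebraMap_toAlgebra χ) b
  have hu : ∀ l, σ (c l) = σ (c j) * χ (chartGen c j l) := fun l => by
    rw [← hσ, ← hσ, ← map_mul, ← reesChartBase_apply_eq_mul_chartGen c j l]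
  have hujj : χ (chartGen c j j) = 1 := by rw [show chartGen c j j = 1 from chartGen_self c j, map_one]
  have ht : Φ (chartBase c j (c j)) = 0 := by rw [hΦbase, hψj, map_zero]
  have hg0 : ψ (G 0) = 1 := by rw [hG0, map_one]
  have hKχ : ∀ z U : chartRing c j, χ (splitCone z U (fun i => chartBase c j (G i)) n) =
      splitCone (χ z) (χ U) (fun i => σ (G i)) n := fun z U => by
    rw [map_splitCone]; simp only [hσ]
  have hKΦ : ∀ z U : chartRing c j, Φ (splitCone z U (fun i => chartBase c j (G i)) n) =
      splitCone (Φ z) (Φ U) (fun i => C (ψ (G i))) n := fun z U => by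
    rw [map_splitCone]; simp only [hΦbase]
  -- the fibre test: `χ K + t·r ∈ 𝔪_Sⁿ ⇒ s·Φ K ∈ 𝔫ⁿ`, `s ∉ 𝔫`
  have htest : ∀ (K₀ : chartRing c j) (r : S), χ K₀ + σ (c j) * r ∈ maximalIdeal S ^ n →
      ∃ s ∉ 𝔫, s * Φ K₀ ∈ 𝔫 ^ n := fun K₀ r hF =>
    PinchTower.exists_mul_mem_pow_fibre 𝔴.asIdeal Φ 𝔫 hΦ𝔴 ht (r := r) (F' := χ K₀ + σ (c j) * r)
      (by rw [halg, halg, hσ]) hF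
  obtain rfl | rfl | rfl : j = 0 ∨ j = 1 ∨ j = 2 := by fin_cases j <;> simp
  · exfalso
    obtain ⟨r, hr⟩ := split_factor_Z σ c (σ (c 0)) (fun l => χ (chartGen c 0 l)) G ε h hu hujj hk hh
    obtain ⟨s, hs, hsB⟩ := htest (splitCone 1 (chartGen c 0 1) (fun i => chartBase c 0 (G i)) n) r
      (by rw [hKχ, map_one]; exact hle (mem_colon_of_map_eq σ hf hr))
    rw [hKΦ, map_one, hΦgen 1 (by decide), splitCone_one_left] at hsB
    exact kernel_Z_prime hn hg0 hNP _ h𝔫 hs hsB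
  · exfalso
    obtain ⟨r, hr⟩ := split_factor_U σ c (σ (c 1)) (fun l => χ (chartGen c 1 l)) G ε h hu hujj hk hh
    obtain ⟨s, hs, hsB⟩ := htest (splitCone (chartGen c 1 0) 1 (fun i => chartBase c 1 (G i)) n) r
      (by rw [hKχ, map_one]; exact hle (mem_colon_of_map_eq σ hf hr))
    rw [hKΦ, map_one, hΦgen 0 (by decide), splitCone_one_right] at hsB
    exact kernel_U_prime hg0 hNP _ h𝔫 hs hsB
  · refine ⟨rfl, ?_⟩
    obtain ⟨r, hr⟩ := split_factor_W' σ c (σ (c 2)) (fun l => χ (chartGen c 2 l)) G ε h hu hujj hk hh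
    obtain ⟨s, hs, hsB⟩ := htest (splitCone (chartGen c 2 0) (chartGen c 2 1) (fun i => chartBase c 2 (G i)) n) r
      (by rw [hKχ]; exact hle (mem_colon_of_map_eq σ hf hr))
    rw [hKΦ, hΦgen 0 (by decide), hΦgen 1 (by decide), splitCone] at hsB
    obtain ⟨h0, h1⟩ := kernel_W_prime hn hg0 hNP (a := (⟨0, by decide⟩ : {i : Fin 3 // i ≠ 2}))
      (b := ⟨1, by decide⟩) (by simp) h𝔫 hs hsB
    intro l hl
    obtain rfl | rfl | rfl : l = 0 ∨ l = 1 ∨ l = 2 := by fin_cases l <;> simp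
    · exact (hΦ𝔴 _).mpr (by rw [hΦgen 0 (by decide)]; exact h0)
    · exact (hΦ𝔴 _).mpr (by rw [hΦgen 1 (by decide)]; exact h1)
    · exact absurd rfl hl

/-- **THE `NotPow` CHART LAW over `κ(A)`** (the unit type of a closed point): if the reduced vertex coefficients are
`NotPow` over the residue field and `J' ⊆ 𝔪_Sⁿ` then `j = 2` and `e₀, e₁ ∈ 𝔴`. [cite: Hironaka1964, Ch. III §3] -/
theorem notPow_chart (c : Fin 3 → A) (hq : IsQuasiRegular c) (hcm : ∀ l, c l ∈ maximalIdeal A) {J : Ideal A}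
    {G : ℕ → A} {ε h : A} {n k : ℕ} (hf : splitCone (c 0) (c 1) G n + ε * c 2 ^ k + h ∈ J)
    (hh : h ∈ WtIdeal c n k (n * k + 1)) (hn : 1 ≤ n) (hk : n + 1 ≤ k) (hG0 : G 0 = 1)
    (hNP : NotPow (ResidueField A) n (fun i => residue A (G i))) (j : Fin 3) (𝔴 : PrimeSpectrum (chartRing c j))
    {S : Type} [CommRing S] [IsLocalRing S] (χ : chartRing c j →+* S)
    (hlocχ : @IsLocalization.AtPrime _ _ S _ χ.toAlgebra 𝔴.asIdeal _)
    (h𝔴 : 𝔴.asIdeal.comap (chartBase c j) = maximalIdeal A) (σ : A →+* S) (hσ : ∀ x, χ (chartBase c j x) = σ x)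
    (hle : Submodule.colon (J.map σ) ((Ideal.span {σ (c j)} ^ n : Ideal S) : Set S) ≤ maximalIdeal S ^ n) :
    j = 2 ∧ ∀ l, l ≠ j → chartGen c j l ∈ 𝔴.asIdeal := by
  obtain ⟨h𝔫, hΦ𝔴⟩ := map_fibreMap_isPrime c j hq hcm (𝔴 := 𝔴.asIdeal) h𝔴
  exact notPow_chart_of_fibre c hf hh hn hk hG0 j 𝔴 χ hlocχ σ hσ (residue A) hNP (fibreMap c j hq hcm)
    (fun l hl => fibreMap_gen c j hq hcm hl) (fibreMap_base c j hq hcm) ((residue_eq_zero_iff _).mpr (hcm j)) _ h𝔫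
    hΦ𝔴 hle

/-- **A middle unit makes the reduced vertex coefficients `NotPow`** (the guard kills `C(n, i)` in `κ(A)`).
[this node] -/
theorem notPow_of_unit {G : ℕ → A} {n : ℕ} (hguard : BinomGuard (maximalIdeal A) n) {i : ℕ} (hi0 : 0 < i)
    (hin : i < n) (hu : IsUnit (G i)) : NotPow (ResidueField A) n (fun l => residue A (G l)) :=
  notPow_of_choose_eq_zero hin.le ((residue_ne_zero_iff_isUnit _).mpr hu)
    (by rw [← map_natCast (residue A), residue_eq_zero_iff]; exact hguard i hi0 hin)

end NotPowChart

/-! ## §C  The core charts -/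

section Core

/-- **Off the line `{e₀ = 0}` a core cone is a unit**: `G₀ = 1`, `Gᵢ ∈ 𝔪_A` (`1 ≤ i ≤ n`), `χ e₀` a unit (or the
`z`-chart, where `e₀ = 1`): `splitCone (χ e₀) U (σ G) n + t·r` is a unit of `S`. [folklore] -/
theorem isUnit_splitCone_add {S : Type} [CommRing S] [IsLocalRing S] (σ : A →+* S)
    (hloc : ∀ x, σ x ∈ maximalIdeal S ↔ x ∈ maximalIdeal A) {G : ℕ → A} {n : ℕ} (hG0 : G 0 = 1)
    (hcore : ∀ i, 0 < i → i ≤ n → G i ∈ maximalIdeal A) {z : S} (hz : IsUnit z) (U : S) {t : S}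
    (ht : t ∈ maximalIdeal S) (r : S) : IsUnit (splitCone z U (fun i => σ (G i)) n + t * r) := by
  rw [splitCone, Finset.sum_range_succ', hG0, map_one, one_mul, Nat.sub_zero, pow_zero, mul_one,
    add_comm _ (z ^ n), add_assoc]
  refine isUnit_add_of_mem (hz.pow n) (Ideal.add_mem _ (Ideal.sum_mem _ fun i hi => ?_) (Ideal.mul_mem_right _ _ ht))
  exact Ideal.mul_mem_right _ _ (Ideal.mul_mem_right _ _
    ((hloc _).mpr (hcore (i + 1) i.succ_pos (by have := Finset.mem_range.mp hi; omega))))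

/-- **THE CORE CHART LAW**: `Gᵢ ∈ 𝔪_A` (`1 ≤ i ≤ n`); then the controlled transform is the unit ideal UNLESS the
point lies on the fibre line `{e₀ = 0}` of the `u`- or the `W`-chart. [cite: Hironaka1964, Ch. III §3] -/
theorem core_chart_top (c : Fin 3 → A) {J : Ideal A} {G : ℕ → A} {ε h : A} {n k : ℕ}
    (hf : splitCone (c 0) (c 1) G n + ε * c 2 ^ k + h ∈ J) (hh : h ∈ WtIdeal c n k (n * k + 1))
    (hk : n + 1 ≤ k) (hG0 : G 0 = 1) (hcore : ∀ i, 0 < i → i ≤ n → G i ∈ maximalIdeal A)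
    (hcm : ∀ l, c l ∈ maximalIdeal A) (j : Fin 3) (𝔴 : PrimeSpectrum (chartRing c j)) {S : Type} [CommRing S]
    [IsLocalRing S] (χ : chartRing c j →+* S) (hlocχ : @IsLocalization.AtPrime _ _ S _ χ.toAlgebra 𝔴.asIdeal _)
    (h𝔴 : 𝔴.asIdeal.comap (chartBase c j) = maximalIdeal A) (σ : A →+* S) (hσ : ∀ x, χ (chartBase c j x) = σ x) :
    Submodule.colon (J.map σ) ((Ideal.span {σ (c j)} ^ n : Ideal S) : Set S) = ⊤ ∨
      (j ≠ 0 ∧ chartGen c j 0 ∈ 𝔴.asIdeal) := by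
  classical
  obtain ⟨hu, hloc, hχ, hujj⟩ := chart_dict c j 𝔴 χ hlocχ h𝔴 σ hσ
  by_cases h0 : j ≠ 0 ∧ chartGen c j 0 ∈ 𝔴.asIdeal
  · exact Or.inr h0
  left
  have ht : σ (c j) ∈ maximalIdeal S := (hloc _).mpr (hcm j)
  have hunit : ∀ {f' : S}, σ (splitCone (c 0) (c 1) G n + ε * c 2 ^ k + h) = σ (c j) ^ n * f' → IsUnit f' →
      Submodule.colon (J.map σ) ((Ideal.span {σ (c j)} ^ n : Ideal S) : Set S) = ⊤ := fun hr hf' =>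
    Ideal.eq_top_of_isUnit_mem _ (mem_colon_of_map_eq σ hf hr) hf'
  obtain rfl | rfl | rfl : j = 0 ∨ j = 1 ∨ j = 2 := by fin_cases j <;> simp
  · obtain ⟨r, hr⟩ := split_factor_Z σ c (σ (c 0)) (fun l => χ (chartGen c 0 l)) G ε h hu hujj hk hh
    exact hunit hr (isUnit_splitCone_add σ hloc hG0 hcore isUnit_one _ ht r)
  · have he : IsUnit (χ (chartGen c 1 0)) := by
      refine IsLocalRing.notMem_maximalIdeal.mp fun hm => h0 ⟨by decide, (hχ _).mp hm⟩
    obtain ⟨r, hr⟩ := split_factor_U σ c (σ (c 1)) (fun l => χ (chartGen c 1 l)) G ε h hu hujj hk hh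
    exact hunit hr (isUnit_splitCone_add σ hloc hG0 hcore he _ ht r)
  · have he : IsUnit (χ (chartGen c 2 0)) := by
      refine IsLocalRing.notMem_maximalIdeal.mp fun hm => h0 ⟨by decide, (hχ _).mp hm⟩
    obtain ⟨r, hr⟩ := split_factor_W' σ c (σ (c 2)) (fun l => χ (chartGen c 2 l)) G ε h hu hujj hk hh
    exact hunit hr (isUnit_splitCone_add σ hloc hG0 hcore he _ ht r)

end Core

end Summit.ResolutionOfSingularities.ResolutionOfSingularities.Theorems.SplitTower
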